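import Summits.BirchSwinnertonDyer.BirchSwinnertonDyer.Theorems.EisensteinPrimesAcTwistDeformationLocSurj
import Summits.BirchSwinnertonDyer.BirchSwinnertonDyer.Theorems.EisensteinPrimesAcTwistDeformationResidualPair
import Summits.BirchSwinnertonDyer.BirchSwinnertonDyer.Theorems.EisensteinPrimesUnrSelmerLocSurjAdapter
import Summits.BirchSwinnertonDyer.BirchSwinnertonDyer.Theorems.EisensteinPrimesGoodLatticeCorankOfGe
import Summits.BirchSwinnertonDyer.BirchSwinnertonDyer.Theorems.UniversalToricDescentSigmaLocalStabilizer
import HarnessLib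

/-!
# Route `EisensteinPrimes` (rung K5), crux 2 `GoodLatticeBDPValue`, line `halves`: **[PWL-θ] — the `≥`
# half of the character `S`-relaxation corank identity AT THE RESIDUAL PAIR, IN THE KERNEL from the five
# Greenberg facts** (`prop125_residualPair_unrSelmer_corank_ge_of_facts`; replaces the PUB-composed stub
# `stub_imprimCorank` of `Lines/halves.lean` v16 — skeleton v17)

Cell `bsd-eis`, seat `bsd-line-x1-p1` LEAD g2 (D-0154 row 4); tenth file of road (A) of verdict v3.1 §3.
`KellerYin2024.prop125_residualPair_unrSelmer_corank_ge` ([PWL-θ], Pollack–Weston 2011 Prop. A.2 ∘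
KY/CGLS Lemma 1.1.1, typed as the `≥` inequality `Σ_{w∈Sf} λ(𝒫_w(θ)) ≤ corank_{ℤ_p}(H¹_{𝓕_nr^{Sf}}/H¹_{𝓕_nr})`
at the residual pair) is DERIVED from Greenberg 2016 Prop. 2.6.3 (`prop263_sur_of_crk`) and Greenberg 2006
Props. 4.1, 4.2, 3.2, §5 A BY NAME:

* the one-variable twist deformation `𝐃₁(θ) = ℚ_p/ℤ_p(θ) ⊗ Λ^*(κ⁻¹)` over `K_S/K`, `S = {v, v̄} ∪ Sf`
  (files 1–3: cofree of corank one, LEO by the corank squeeze, LOC⁽¹⁾, CRK ⇒ `SUR(𝐃₁(θ), 𝓛_v)`;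
  the residual-pair instantiation of its inputs — `θ` unramified outside `S` by Néron–Ogg–Shafarevich,
  the `σ`-supply by Brink / class field theory, `corank_Λ S_{𝓛_v} = 0` from [RH] through the Shapiro
  descent — is width seat w3's `…AcTwistDeformationResidualPair`);
* Shapiro's lemma (files 4–8): `SUR(𝐃₁(θ), 𝓛_v)` ⇒ the `K_∞`-side global-to-local map
  `H¹_{𝓕_nr^{Sf}}(K_∞, (F/𝒪)(θ)) → ∏_{w∈Sf} ∏_{i<p^{a_w}} H¹(ker κ ⊓ D_w, (F/𝒪)(θ))`, `u ↦ (res conj_{γ^i} u)`,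
  is onto (`exists_mem_unrSelmer_forall_resOfLe_conjH1_eq`, `p^{a_w} = [Γ:Γ_w] = numPlacesAbove κ w`);
* the corank bookkeeping (width seat w2: kernel `= H¹_{𝓕_nr}`, coranks add, `numPlacesAbove = p^{a_w}`,
  `κ(γ^i) = i`) and the per-place lower bound `corank H¹(ker κ ⊓ D_w, (F/𝒪)(θ)) ≥ 𝟙[θ(Frob_w) ≡ Nw]`
  (w2's `CharLocalTameCorank`, KY Lemma 1.1.1).

HONEST FRAMING: the theorem is CONDITIONAL on the five published facts by name (its hypotheses) and on
nothing else; no new definition, no named fact introduced, no `sorry`; BSD / IMC2 / the crux are NOT proved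
by this file alone (it removes one PUB-composed stub from the line). References: [Greenberg2016Selmer]
Prop. 2.6.3; [Greenberg2006] Props. 3.2, 4.1, 4.2, §5 A; [PollackWeston2011] App. A Prop. A.2;
[KellerYin2024] Prop. 1.2.5, Lemma 1.1.1, Rem. 1.2.3 (ii) (arXiv:2402.12781v2 TeX L780–800, L455–462,
L690–712); [CastellaGrossiLeeSkinner2022] Prop. 1.2.5; [SkinnerUrban2014] §3.1.2, Prop. 3.2.3;
[GreenbergVatsal2000] §2 pp. 16–22; [Brink2007] Thm. 2.
-/

set_option autoImplicit false
set_option linter.dupNamespace false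

noncomputable section

open scoped Classical
open NumberField IsDedekindDomain Field Multiplicative PowerSeries WeierstrassCurve
open Literature.NumberTheory.EllipticCurves Literature.NumberTheory.EllipticCurves.GreenbergSelmer
  Literature.NumberTheory.EllipticCurves.GreenbergVatsal2000 Literature.NumberTheory.GaloisRepresentations
  Literature.NumberTheory.EllipticCurves.KellerYin2024 Literature.NumberTheory.EllipticCurves.IwasawaDual
  Literature.NumberTheory.IwasawaTheory Literature.NumberTheory.IwasawaTheory.Greenberg2016
  Literature.NumberTheory.IwasawaTheory.Greenberg2006
  Summit.BirchSwinnertonDyer.BirchSwinnertonDyer.Theorems.GreenbergFullAtSelmer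
  Summit.BirchSwinnertonDyer.BirchSwinnertonDyer.Theorems.AcTwistDeformationResidualPair
  Summit.BirchSwinnertonDyer.BirchSwinnertonDyer.Theorems.UnrSelmerQuotientTorsionFiniteChar

namespace Summit.BirchSwinnertonDyer.BirchSwinnertonDyer.Theorems.AcTwistDeformation

/-- **[PWL-θ] `≥` AT THE RESIDUAL PAIR, FROM THE FIVE GREENBERG FACTS.** Under Greenberg 2016 Prop. 2.6.3
(`SUR` from `LEO` + `CRK`) and Greenberg 2006 Props. 4.1, 4.2, §5 A, 3.2 (Euler–Poincaré coranks, local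
duality for `H²`, cofinite generation) BY NAME, `KellerYin2024.prop125_residualPair_unrSelmer_corank_ge`
holds: for `W/ℚ` globally minimal with `Good/Red/Anom` at `p > 2`, `K` imaginary quadratic with (Heeg) for
`N_E` and `p`, `v`/`v̄` the places above `p`, `κ` anticyclotomic with topological generator `γ`,
`θ ∈ {θsub, θquot}` the residual pair of `E[p]` over `K`, `Sf` the places over `N_E`, and [RH]
(`H¹_{𝓕_nr}(K_∞, (F/𝒪)(θ))^∨` finitely generated `Λ`-torsion with `μ = 0`):
`Σ_{w∈Sf} charLocalLambda ∅ κ θ w ≤ corank_{ℤ_p}(H¹_{𝓕_nr^{Sf}}/H¹_{𝓕_nr})`.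
[cite: Greenberg2016Selmer, Prop. 2.6.3 (§2.6 p. 10)] [cite: Greenberg2006, Props. 3.2, 4.1, 4.2, §5 A]
[cite: PollackWeston2011, App. A Prop. A.2] [cite: KellerYin2024, Prop. 1.2.5 (eq:Gr to imp), Lemma 1.1.1, Rem. 1.2.3 (ii) (arXiv:2402.12781v2 TeX L780–800, L455–462, L690–712)]
[cite: CastellaGrossiLeeSkinner2022, Prop. 1.2.5 (proof, (eq:sur1)–(eq:sur2))] [cite: SkinnerUrban2014, §3.1.2 and Prop. 3.2.3] -/
theorem prop125_residualPair_unrSelmer_corank_ge_of_facts (h263 : prop263_sur_of_crk)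
    (h41 : prop41_globalEulerPoincareCorank) (h42 : prop42_localEulerPoincareCorank)
    (h5A : sec5A_localH2_subsingleton_of_LOC1) (h32 : prop32_cohomology_isCofinitelyGenerated) :
    prop125_residualPair_unrSelmer_corank_ge := by
  intro W _ _ p _ hp hgood hred hanom hlat K _ _ hK hH hHp htor ι v vbar hvι hvbar hne κ hκ γ _ θsub θquot
    hpair Sf hSf θ hθ hRH
  have hγ : κ.IsTopGenerator γ := Fact.out
  have hv : ((p : ℕ) : 𝓞 K) ∈ v.asIdeal := IwasawaTwoVariable.natCast_mem_asIdeal_of_norm_iff hvι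
  have hpN : ¬ p ∣ W.conductorNorm ℤ := fun hd ↦
    (W.dvd_conductorNorm_iff_not_hasGoodReductionAtPrime p).mp hd hgood
  have hSfp : ∀ w ∈ Sf, ((p : ℕ) : 𝓞 K) ∉ w.asIdeal := fun w hw ↦
    GoodLatticeCorankOfGe.natCast_notMem_of_intCast_mem hpN Fact.out w ((hSf w).mp hw)
  have hSp : ∀ w : HeightOneSpectrum (𝓞 K), ((p : ℕ) : 𝓞 K) ∈ w.asIdeal → w = v ∨ w = vbar :=
    fun w hw ↦ eq_or_eq_of_natCast_mem_of_ne hK.1 hv hvbar hne hw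
  have hθpow : ∀ σ : absoluteGaloisGroup K, θ σ ^ (p - 1) = 1 := fun σ ↦ by
    rcases hθ with rfl | rfl
    · exact (hpair.pow_sub_one σ).1
    · exact (hpair.pow_sub_one σ).2
  -- every `w ∈ Sf` is finitely decomposed in `K_∞^{ac}` (Brink), with `κ(D_w) = p^{a_w} ℤ_p` exactly
  have hdec : ∀ w ∈ Sf, ¬ decomp (K := K) w ≤ κ.kerSubgroup := fun w hw hle ↦ by
    obtain ⟨δ, hδ, hne1⟩ := exists_mem_decomp_apply_ne_one_of_heegner hK hp hH κ hκ w ((hSf w).mp hw)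
      (hSfp w hw)
    exact hne1 (ZpExtension.mem_kerSubgroup.mp (hle hδ))
  have hexp : ∀ w : HeightOneSpectrum (𝓞 K), ∃ a : ℕ, w ∈ Sf →
      (∃ δ ∈ decomp (K := K) w, (κ δ).toAdd = (p : ℤ_[p]) ^ a) ∧
        ∀ δ ∈ decomp (K := K) w, (p : ℤ_[p]) ^ a ∣ (κ δ).toAdd := by
    intro w
    by_cases hw : w ∈ Sf
    · obtain ⟨c, ⟨d₀, hd₀⟩, -, hdvd⟩ :=
        UniversalToricDescentSigmaLocalStabilizer.exists_pow_and_forall_dvd_of_not_le κ w (hdec w hw)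
      exact ⟨c, fun _ ↦ ⟨⟨d₀, d₀.2, hd₀⟩, fun δ hδ ↦ hdvd ⟨δ, hδ⟩⟩⟩
    · exact ⟨0, fun h ↦ (hw h).elim⟩
  choose a ha using hexp
  have hd₀ : ∀ w ∈ Sf, ∃ δ ∈ decomp (K := K) w, (κ δ).toAdd = (p : ℤ_[p]) ^ a w :=
    fun w hw ↦ (ha w hw).1
  have hdiv : ∀ w ∈ Sf, ∀ δ ∈ decomp (K := K) w, (p : ℤ_[p]) ^ a w ∣ (κ δ).toAdd :=
    fun w hw ↦ (ha w hw).2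
  -- the representatives `γ^i` of the places above `w`: `κ(γ^i) = i`
  have hσrep : ∀ w ∈ Sf, ∀ i : ℕ, i < p ^ a w → (κ ((fun (_ : HeightOneSpectrum (𝓞 K)) (i : ℕ) ↦ γ ^ i) w i)).toAdd =
      (i : ℤ_[p]) := fun w _ i _ ↦ by
    change (κ (γ ^ i)).toAdd = (i : ℤ_[p])
    rw [map_pow, show κ γ = Multiplicative.ofAdd 1 from hγ, ← ofAdd_nsmul, toAdd_ofAdd, nsmul_one]
  -- `S = {v, v̄} ∪ Sf`; `θ` is unramified outside `S`
  have hS : ∀ w : HeightOneSpectrum (𝓞 K), ((p : ℕ) : 𝓞 K) ∈ w.asIdeal →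
      w ∈ (↑(insert v (insert vbar Sf)) : Set (HeightOneSpectrum (𝓞 K))) :=
    mem_insert_insert_of_natCast_mem hK hv hvbar hne Sf
  have hSfS : ∀ w ∈ Sf, w ∈ (↑(insert v (insert vbar Sf)) : Set (HeightOneSpectrum (𝓞 K))) :=
    fun w hw ↦ by
    rw [Finset.coe_insert, Finset.coe_insert]
    exact Or.inr (Or.inr (Finset.mem_coe.mpr hw))
  have h : ramificationSubgroup K (↑(insert v (insert vbar Sf)) : Set (HeightOneSpectrum (𝓞 K))) ≤
      (unitChar θ).toMonoidHom.ker :=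
    ramificationSubgroup_le_ker_unitChar_of_residualPair W hpair Sf hSf _ hSfS hS θ hθ
  -- the canonical (discrete) topological instances of the model
  letI tΛ : TopologicalSpace (PowerSeries ℤ_[p]) := ⊥
  haveI : DiscreteTopology (PowerSeries ℤ_[p]) := ⟨rfl⟩
  haveI : IsTopologicalRing (PowerSeries ℤ_[p]) := inferInstance
  haveI hAdisc : DiscreteTopology (QpModZp p) := QpModZp.discreteTopology p
  haveI : IsTopologicalAddGroup (BigRepModule ℤ_[p] p (QpModZp p)) := inferInstance
  haveI : ContinuousSMul (PowerSeries ℤ_[p]) (BigRepModule ℤ_[p] p (QpModZp p)) := inferInstance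
  -- the model `ρ_θ` on `ℚ_p/ℤ_p`, `ψ = (charModuleEquiv θ)⁻¹`, the Shapiro descent `F`, and [RH]
  have hψ := charModuleEquiv_symm_galois (↑(insert v (insert vbar Sf)) : Set (HeightOneSpectrum (𝓞 K))) θ h
  obtain ⟨F, hF⟩ := exists_shapiroDescent _ hS κ (characterRepUnramified _ θ h) (charModuleEquiv θ).symm hψ
  obtain ⟨hSel, hSelfg⟩ := hasCorank_fullAtSelmer_zero_of_RH hK κ hγ hv hvbar hne θ _ hS h hRH
  -- the `K_∞`-side global-to-local surjectivity (file 8)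
  have h8 : ∀ y : ∀ w : HeightOneSpectrum (𝓞 K), ℕ →
      subgroupH1 (κ.kerSubgroup ⊓ decomp (K := K) w) (charModule (∅ : Set (PadicAlgCl p)) θ),
      ∃ u ∈ unrSelmer κ (charModule (∅ : Set (PadicAlgCl p)) θ) vbar (↑Sf : Set (HeightOneSpectrum (𝓞 K))),
        ∀ w ∈ Sf, ∀ i : ℕ, i < p ^ a w →
          resOfLe (charModule (∅ : Set (PadicAlgCl p)) θ)
            (inf_le_left : κ.kerSubgroup ⊓ decomp (K := K) w ≤ κ.kerSubgroup)
            (conjH1 κ.kerSubgroup (charModule (∅ : Set (PadicAlgCl p)) θ) (γ ^ i) u) = y w i := fun y ↦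
    exists_mem_unrSelmer_forall_resOfLe_conjH1_eq _ hS κ (characterRepUnramified _ θ h)
      (charModuleEquiv θ).symm hψ h263 h41 h42 h5A h32 (Finset.finite_toSet _) hK
      (LinearEquiv.refl ℤ_[p] (QpModZp p)) (characterRepUnramified_hscalar _ θ h)
      (exists_local_apply_ne_one_of_mem_insert_insert hK hp hH κ hκ hv hvbar Sf hSf)
      hne hv hvbar hSp hSel hSelfg (fun b ↦ QpModZp.exists_pow_nsmul_eq_zero b) hF Sf hSfS hSfp a hdiv hd₀
      (fun _ i ↦ γ ^ i) hσrep y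
  -- corank bookkeeping (width seat w2): the surjection has kernel `H¹_{𝓕_nr}`, coranks add over the
  -- `Σ_{w∈Sf} numPlacesAbove κ w` factors (`numPlacesAbove κ w = p^{a_w}`), each of corank `≥ 𝟙[θ(Frob_w) ≡ Nw]`
  exact UnrSelmerLocSurjAdapter.sum_charLocalLambda_le_zpCorank_unrSelmer_quotient_at_residualPair_of_forall_exists
    κ θ vbar Sf hK hp hH hκ hγ θsub θquot hpair hSf hSfp hθ a hdiv hd₀ (fun _ i ↦ γ ^ i) hσrep h8

end Summit.BirchSwinnertonDyer.BirchSwinnertonDyer.Theorems.AcTwistDeformation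

end
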